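import Literature.Analysis.PDE.LinearWaveFrameRecoverySource
import Literature.Analysis.PDE.SymmetricHyperbolicExistence
import HarnessLib

/-!
# Linear diagonal second-order hyperbolic systems with first-order coupling: the symmetric
# first-order form in frame variables and the existence of smooth solutions

Analysis/PDE support file (everything proved; the definitions are explicit coefficient matrices).
A linear **diagonal** second-order system for `κ` scalar unknowns `f_K` on `ℝ × ℝⁿ`,

  `P f_K + Σ_J (c⁰_{KJ} f_J + cᵀ_{KJ} ∂_t f_J + Σ_j cˣ_{KJj} ∂_j f_J) = 0`,
  `P = −a ∂_t² + 2aβʲ ∂_t∂_j + (Q^{jk} − aβʲβᵏ) ∂_j∂_k` (`WaveFrame.P a β Q 0 0 0`),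

with the same principal part for all components (as for the components of a tensor wave
equation `□T = …`, `Literature.Geometry.Lorentzian.MetricCoord.tlap_eq_principal_add_lower`) and an
arbitrary smooth coupling through the `1`-jets, is reduced, component by component, to John's
symmetric first-order form in the frame variables `(f_K, ϖ_K = √a D₀ f_K, ψ_{K,l} = e_lᵏ ∂_k f_K)`
of `LinearWaveFrameSystem.lean`: the coupling is of order zero in these variables, so the big
system `∂_t U = Σ_j A_j ∂_j U + B U` for `U = (f_K, ϖ_K, ψ_{K,l})_{K,l}` (`Acoef`, `Bcoef`, `Aop`,
`Bop`) has the block-diagonal **symmetric** principal part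
`A_j = βʲ·1 + (√a)⁻¹ e_lʲ (E_{ϖψ_l} + E_{ψ_lϖ})` of the scalar case (`inner_Aop_comm`) — Friedrichs'
format (Friedrichs 1954, §1; John 1982, Ch. 5 §3; Alinhac 2009, Ex. 7.5). For a classical
solution `U` of the big system (`rows_of_solution`) the components satisfy the `f`-, `ψ`- and
`ϖ`-rows of `LinearWaveFrameRecovery.lean`, the last one with the coupling as a source, so that
`WaveFrame.eventually_P_eq_of_rows_source` recovers the second-order system near the initial
slice; with Friedrichs' existence theorem (`Literature.Analysis.PDE.exists_smooth_solution`) this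
gives **`WaveSystem.exists_solution`**: for regular admissible coefficients and `C_c^∞` Cauchy data
`(f₀, f₁)` there is a smooth `f` with the data `f_K(0,·) = f₀_K`, `∂_t f_K(0,·) = f₁_K` solving the
coupled second-order system on a neighbourhood of the initial slice `{t = 0}`.

## References

* K. O. Friedrichs, *Symmetric hyperbolic linear differential equations*, CPAM 7 (1954), §1.
  [Friedrichs1954]
* F. John, *Partial differential equations*, 4th ed., Springer 1982, Ch. 5 §3. [John1982]
* S. Alinhac, *Hyperbolic Partial Differential Equations*, Springer 2009, §7.6, Ex. 7.5. [Alinhac2009]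
-/

noncomputable section

open Set Filter
open scoped Topology ContDiff RealInnerProductSpace

namespace Literature.Analysis.PDE

/-! ### Continuous linear maps of a Euclidean space from coefficient matrices -/

section OfCoef

variable {σ : Type*} [Fintype σ] [DecidableEq σ]

/-- The matrix unit `E_{ab}` of `ℝ^σ`: `(E_{ab} v)_r = δ_{ra} v_b`. [folklore] -/
def munit (a b : σ) : EuclideanSpace ℝ σ →L[ℝ] EuclideanSpace ℝ σ :=
  (EuclideanSpace.proj b).smulRight (EuclideanSpace.single a (1 : ℝ))

/-- Components of `E_{ab} v`. [folklore] -/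
@[simp] theorem munit_apply (a b : σ) (v : EuclideanSpace ℝ σ) (r : σ) :
    munit a b v r = if r = a then v b else 0 := by
  simp [munit, PiLp.single_apply]

/-- The continuous linear map of `ℝ^σ` with coefficient matrix `c`: `(L v)_r = Σ_b c_{rb} v_b`.
[folklore] -/
def ofCoef (c : σ → σ → ℝ) : EuclideanSpace ℝ σ →L[ℝ] EuclideanSpace ℝ σ :=
  ∑ a, ∑ b, c a b • munit a b

/-- Components of `ofCoef c v`. [folklore] -/
theorem ofCoef_apply (c : σ → σ → ℝ) (v : EuclideanSpace ℝ σ) (r : σ) :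
    ofCoef c v r = ∑ b, c r b * v b := by
  simp only [ofCoef, FunLike.coe_sum, Finset.sum_apply, FunLike.coe_smul, Pi.smul_apply]
  rw [WithLp.ofLp_sum, Finset.sum_apply]
  simp only [WithLp.ofLp_sum, Finset.sum_apply, WithLp.ofLp_smul, Pi.smul_apply, smul_eq_mul,
    munit_apply, mul_ite, mul_zero, Finset.sum_ite_irrel, Finset.sum_const_zero, Finset.sum_ite_eq,
    Finset.mem_univ, if_true]

/-- A symmetric coefficient matrix gives a symmetric operator. [folklore] -/
theorem inner_ofCoef_comm {c : σ → σ → ℝ} (hc : ∀ a b, c a b = c b a) (v w : EuclideanSpace ℝ σ) :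
    ⟪ofCoef c v, w⟫ = ⟪v, ofCoef c w⟫ := by
  simp only [PiLp.inner_apply, ofCoef_apply, RCLike.inner_apply, conj_trivial, Finset.sum_mul,
    Finset.mul_sum]
  rw [Finset.sum_comm]
  exact Finset.sum_congr rfl fun a _ ↦ Finset.sum_congr rfl fun b _ ↦ by rw [hc]; ring

/-- Smooth coefficients give a smooth operator field. [folklore] -/
theorem contDiff_ofCoef {E : Type*} [NormedAddCommGroup E] [NormedSpace ℝ E] {c : σ → σ → E → ℝ}
    (hc : ∀ a b, ContDiff ℝ ∞ (c a b)) : ContDiff ℝ ∞ (fun x ↦ ofCoef (fun a b ↦ c a b x)) := by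
  unfold ofCoef
  exact ContDiff.sum fun a _ ↦ ContDiff.sum fun b _ ↦ (hc a b).smul contDiff_const

end OfCoef

namespace WaveSystem

open VarWave WaveFrame

variable {n : ℕ} {κ : Type*} [Fintype κ] [DecidableEq κ]

/-! ### The first-order variables and the coefficient data -/

/-- The slots of the first-order variables attached to one component: `none ↦ f`,
`some none ↦ ϖ`, `some (some l) ↦ ψ_l`. [cite: John1982, Ch. 5 §3] -/
abbrev Slot (n : ℕ) : Type := Option (Option (Fin n))

/-- The index set of the big first-order unknown `U = (f_K, ϖ_K, ψ_{K,l})`. [cite: John1982, Ch. 5 §3] -/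
abbrev Idx (κ : Type*) (n : ℕ) : Type _ := κ × Slot n

/-- **The coefficient data of a coupled diagonal second-order system in frame variables**:
inverse square lapse `a`, shift `β`, inverse slice metric `Q` with inverse `h` and frame `e`
(`Σ_l e_lʲ e_lᵏ = Q^{jk}`), and the coupling coefficients `c⁰, cᵀ, cˣ` of
`Σ_J (c⁰_{KJ} f_J + cᵀ_{KJ} ∂_t f_J + Σ_j cˣ_{KJj} ∂_j f_J)`. [cite: John1982, Ch. 5 §3] -/
structure Coeffs (κ : Type*) (n : ℕ) where
  /-- The inverse square lapse `a = −g⁰⁰ > 0`. -/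
  a : Pt n → ℝ
  /-- The shift `βʲ = g^{0j}/a`. -/
  β : Fin n → Pt n → ℝ
  /-- The inverse slice metric `Q^{jk} = g^{jk} + a βʲβᵏ`. -/
  Q : Fin n → Fin n → Pt n → ℝ
  /-- The slice metric `h = Q⁻¹`. -/
  h : Fin n → Fin n → Pt n → ℝ
  /-- A frame `e_l` of `Q`: `Σ_l e_lʲ e_lᵏ = Q^{jk}`. -/
  e : Fin n → Fin n → Pt n → ℝ
  /-- Coupling coefficient of `f_J` in the `K`-th equation. -/
  c0 : κ → κ → Pt n → ℝ
  /-- Coupling coefficient of `∂_t f_J` in the `K`-th equation. -/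
  cT : κ → κ → Pt n → ℝ
  /-- Coupling coefficient of `∂_j f_J` in the `K`-th equation. -/
  cX : κ → κ → Fin n → Pt n → ℝ

namespace Coeffs

variable (C : Coeffs κ n)

/-- `√a`. [folklore] -/
def sa (q : Pt n) : ℝ := Real.sqrt (C.a q)

/-- `(√a)⁻¹`. [folklore] -/
def isa (q : Pt n) : ℝ := (Real.sqrt (C.a q))⁻¹

/-- **Smooth admissible coefficient data**: all coefficient functions `C^∞`, `a > 0`, `e` a frame of
`Q` and `h = Q⁻¹`. [cite: John1982, Ch. 5 §3] -/
structure IsSmooth : Prop where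
  a : ContDiff ℝ ∞ C.a
  apos : ∀ q, 0 < C.a q
  β : ∀ j, ContDiff ℝ ∞ (C.β j)
  h : ∀ j k, ContDiff ℝ ∞ (C.h j k)
  e : ∀ l k, ContDiff ℝ ∞ (C.e l k)
  hQ : ∀ j k q, ∑ l, C.e l j q * C.e l k q = C.Q j k q
  hinv : ∀ k i q, ∑ j, C.h k j q * C.Q j i q = if k = i then 1 else 0
  c0 : ∀ K J, ContDiff ℝ ∞ (C.c0 K J)
  cT : ∀ K J, ContDiff ℝ ∞ (C.cT K J)
  cX : ∀ K J j, ContDiff ℝ ∞ (C.cX K J j)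

/-- **The coupling** of the second-order system, `Σ_J (c⁰_{KJ} f_J + cᵀ_{KJ} ∂_t f_J + Σ_j cˣ_{KJj} ∂_j f_J)`.
[cite: John1982, Ch. 5 §3] -/
def cpl (f : κ → Pt n → ℝ) (K : κ) (q : Pt n) : ℝ :=
  ∑ J, (C.c0 K J q * f J q + C.cT K J q * VarWave.dT (f J) q + ∑ j, C.cX K J j q * VarWave.dX (f J) j q)

/-- **The coupling in first-order variables** (`∂_t f ↦ (√a)⁻¹ϖ + βʲ F_j`, `∂_j f ↦ F_j = Σ_m ẽ_{mj} ψ_m`):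
the source of the `ϖ`-rows. [cite: John1982, Ch. 5 §3] -/
def cplFO (f ϖ : κ → Pt n → ℝ) (ψ : κ → Fin n → Pt n → ℝ) (K : κ) (q : Pt n) : ℝ :=
  ∑ J, (C.c0 K J q * f J q
    + C.cT K J q * (C.isa q * ϖ J q + ∑ j, C.β j q * Fv C.h C.e (ψ J) j q)
    + ∑ j, C.cX K J j q * Fv C.h C.e (ψ J) j q)

/-! ### The coefficient matrices of the big first-order system -/

/-- **The principal coefficients** `A_j`: `βʲ` on the diagonal and `(√a)⁻¹ e_lʲ` coupling `ϖ_K` with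
`ψ_{K,l}` (symmetric). [cite: John1982, Ch. 5 §3] -/
def Acoef (j : Fin n) (q : Pt n) : Idx κ n → Idx κ n → ℝ
  | (K, none), (J, none) => if K = J then C.β j q else 0
  | (K, some none), (J, some none) => if K = J then C.β j q else 0
  | (K, some none), (J, some (some l)) => if K = J then C.isa q * C.e l j q else 0
  | (K, some (some l)), (J, some none) => if K = J then C.isa q * C.e l j q else 0
  | (K, some (some l)), (J, some (some l')) => if K = J ∧ l = l' then C.β j q else 0
  | (_, none), (_, some _) => 0
  | (_, some _), (_, none) => 0

/-- **The zeroth-order coefficients** `B`: the `f`-row `(√a)⁻¹ ϖ`, the `ψ`-rows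
`Σ_m M_{lm} ψ_m + (e_lᵏ ∂_k (√a)⁻¹) ϖ`, and the `ϖ`-rows `(√a)⁻¹ (bracket + coupling)`.
[cite: John1982, Ch. 5 §3] -/
def Bcoef (q : Pt n) : Idx κ n → Idx κ n → ℝ
  | (K, none), (J, some none) => if K = J then C.isa q else 0
  | (K, some (some l)), (J, some (some m)) => if K = J then Mco C.β C.h C.e l m q else 0
  | (K, some (some l)), (J, some none) =>
      if K = J then ∑ k, C.e l k q * VarWave.dX C.isa k q else 0
  | (K, some none), (J, none) => C.isa q * C.c0 K J q
  | (K, some none), (J, some none) =>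
      (if K = J then C.isa q * (C.sa q * D0 C.β C.sa q * C.isa q) else 0)
        + C.isa q * (C.cT K J q * C.isa q)
  | (K, some none), (J, some (some m)) =>
      (if K = J then C.isa q * (-(C.a q * ∑ j, D0 C.β (C.β j) q * etil C.h C.e m j q)
        - ∑ l, ∑ j, ∑ k, C.e l j q * VarWave.dX (C.e l k) j q * etil C.h C.e m k q) else 0)
        + C.isa q * ∑ j, (C.cT K J q * C.β j q + C.cX K J j q) * etil C.h C.e m j q
  | (_, none), (_, none) => 0
  | (_, none), (_, some (some _)) => 0
  | (_, some (some _)), (_, none) => 0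

/-- The operator field `A_j` of the big system. [cite: Friedrichs1954, §1] -/
def Aop (j : Fin n) (q : Pt n) : EuclideanSpace ℝ (Idx κ n) →L[ℝ] EuclideanSpace ℝ (Idx κ n) :=
  ofCoef (C.Acoef j q)

/-- The operator field `B` of the big system. [cite: Friedrichs1954, §1] -/
def Bop (q : Pt n) : EuclideanSpace ℝ (Idx κ n) →L[ℝ] EuclideanSpace ℝ (Idx κ n) :=
  ofCoef (C.Bcoef q)

omit [Fintype κ] in
/-- **The principal coefficients are symmetric.** [cite: Friedrichs1954, §1] -/
theorem Acoef_comm (j : Fin n) (q : Pt n) (σ τ : Idx κ n) : C.Acoef j q σ τ = C.Acoef j q τ σ := by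
  obtain ⟨K, s⟩ := σ
  obtain ⟨J, s'⟩ := τ
  by_cases hKJ : K = J
  · subst hKJ
    rcases s with _ | _ | l <;> rcases s' with _ | _ | l' <;> simp [Acoef]
    by_cases hl : l = l'
    · subst hl; simp
    · simp [hl, Ne.symm hl]
  · rcases s with _ | _ | l <;> rcases s' with _ | _ | l' <;> simp [Acoef, hKJ, Ne.symm hKJ]

/-- **`A_j(q)` is a symmetric operator of `ℝ^{κ × Slot}`.** [cite: Friedrichs1954, §1] -/
theorem inner_Aop_comm (j : Fin n) (q : Pt n) (u w : EuclideanSpace ℝ (Idx κ n)) :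
    ⟪C.Aop j q u, w⟫ = ⟪u, C.Aop j q w⟫ :=
  inner_ofCoef_comm (C.Acoef_comm j q) u w

/-! ### Smoothness of the coefficient operators -/

section Smooth

variable {C}

omit [Fintype κ] [DecidableEq κ] in
/-- `√a` is smooth. [folklore] -/
theorem contDiff_sa (hC : C.IsSmooth) : ContDiff ℝ ∞ C.sa := contDiff_sqrt_coef hC.a hC.apos

omit [Fintype κ] [DecidableEq κ] in
/-- `(√a)⁻¹` is smooth. [folklore] -/
theorem contDiff_isa (hC : C.IsSmooth) : ContDiff ℝ ∞ C.isa := contDiff_inv_sqrt_coef hC.a hC.apos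

omit [Fintype κ] [DecidableEq κ] in
/-- `ẽ` is smooth. [folklore] -/
theorem contDiff_etil (hC : C.IsSmooth) (m k : Fin n) : ContDiff ℝ ∞ (etil C.h C.e m k) :=
  ContDiff.sum fun j _ ↦ (hC.h k j).mul (hC.e m j)

omit [Fintype κ] [DecidableEq κ] in
/-- `M_{lm}` is smooth. [folklore] -/
theorem contDiff_Mco (hC : C.IsSmooth) (l m : Fin n) : ContDiff ℝ ∞ (Mco C.β C.h C.e l m) := by
  unfold Mco
  exact (ContDiff.sum fun k _ ↦ (contDiff_D0 hC.β (hC.e l k)).mul (contDiff_etil hC m k)).add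
    (ContDiff.sum fun k _ ↦ (hC.e l k).mul (ContDiff.sum fun j _ ↦
      (VarWave.contDiff_dX (hC.β j) k).mul (contDiff_etil hC m j)))

omit [Fintype κ] in
/-- The entries of `A_j` are smooth. [cite: Friedrichs1954, §1] -/
theorem contDiff_Acoef (hC : C.IsSmooth) (j : Fin n) (σ τ : Idx κ n) : ContDiff ℝ ∞ (fun q ↦ C.Acoef j q σ τ) := by
  obtain ⟨K, s⟩ := σ
  obtain ⟨J, s'⟩ := τ
  rcases s with _ | _ | l <;> rcases s' with _ | _ | l' <;> simp only [Acoef] <;>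
    first
    | exact contDiff_const
    | (split_ifs
       · first
         | exact hC.β j
         | exact (contDiff_isa hC).mul (hC.e _ j)
       · exact contDiff_const)

omit [Fintype κ] in
/-- The entries of `B` are smooth. [cite: Friedrichs1954, §1] -/
theorem contDiff_Bcoef (hC : C.IsSmooth) (σ τ : Idx κ n) : ContDiff ℝ ∞ (fun q ↦ C.Bcoef q σ τ) := by
  have hisa := contDiff_isa hC
  have hsa := contDiff_sa hC
  obtain ⟨K, s⟩ := σ
  obtain ⟨J, s'⟩ := τ
  rcases s with _ | _ | l <;> rcases s' with _ | _ | m <;> simp only [Bcoef]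
  · exact contDiff_const
  · split_ifs
    · exact hisa
    · exact contDiff_const
  · exact contDiff_const
  · exact hisa.mul (hC.c0 K J)
  · refine ContDiff.add ?_ (hisa.mul ((hC.cT K J).mul hisa))
    split_ifs
    · exact hisa.mul ((hsa.mul (contDiff_D0 hC.β hsa)).mul hisa)
    · exact contDiff_const
  · refine ContDiff.add ?_ (hisa.mul (ContDiff.sum fun j _ ↦
      (((hC.cT K J).mul (hC.β j)).add (hC.cX K J j)).mul (contDiff_etil hC m j)))
    split_ifs
    · refine hisa.mul (ContDiff.sub (ContDiff.neg (hC.a.mul (ContDiff.sum fun j _ ↦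
        (contDiff_D0 hC.β (hC.β j)).mul (contDiff_etil hC m j)))) ?_)
      exact ContDiff.sum fun l _ ↦ ContDiff.sum fun j _ ↦ ContDiff.sum fun k _ ↦
        ((hC.e l j).mul (VarWave.contDiff_dX (hC.e l k) j)).mul (contDiff_etil hC m k)
    · exact contDiff_const
  · exact contDiff_const
  · split_ifs
    · exact ContDiff.sum fun k _ ↦ (hC.e l k).mul (VarWave.contDiff_dX hisa k)
    · exact contDiff_const
  · split_ifs
    · exact contDiff_Mco hC l m
    · exact contDiff_const

/-- **`A_j` is a smooth operator field.** [cite: Friedrichs1954, §1] -/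
theorem contDiff_Aop (hC : C.IsSmooth) (j : Fin n) : ContDiff ℝ ∞ (C.Aop j) :=
  contDiff_ofCoef (c := fun σ τ q ↦ C.Acoef j q σ τ) fun σ τ ↦ contDiff_Acoef hC j σ τ

/-- **`B` is a smooth operator field.** [cite: Friedrichs1954, §1] -/
theorem contDiff_Bop (hC : C.IsSmooth) : ContDiff ℝ ∞ C.Bop :=
  contDiff_ofCoef (c := fun σ τ q ↦ C.Bcoef q σ τ) fun σ τ ↦ contDiff_Bcoef hC σ τ

end Smooth

end Coeffs

/-! ### The components of a classical solution of the big system satisfy the rows -/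

section Solution

variable (C : Coeffs κ n)

/-- The `σ`-component of a time-dependent field `U`, as a function on `ℝ × ℝⁿ`. [folklore] -/
def comp (U : ℝ → EuclideanSpace ℝ (Fin n) → EuclideanSpace ℝ (Idx κ n)) (σ : Idx κ n) :
    Pt n → ℝ :=
  fun p ↦ U p.1 p.2 σ

variable {C} {U : ℝ → EuclideanSpace ℝ (Fin n) → EuclideanSpace ℝ (Idx κ n)}

omit [Fintype κ] [DecidableEq κ] in
/-- Unfolding lemma for `comp`. [folklore] -/
@[simp] theorem comp_apply (U : ℝ → EuclideanSpace ℝ (Fin n) → EuclideanSpace ℝ (Idx κ n))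
    (σ : Idx κ n) (p : Pt n) : comp U σ p = U p.1 p.2 σ := rfl

omit [DecidableEq κ] in
/-- The components of a jointly smooth field are smooth. [folklore] -/
theorem contDiff_comp (hU : ContDiff ℝ ∞ fun p : Pt n ↦ U p.1 p.2) (σ : Idx κ n) :
    ContDiff ℝ ∞ (comp U σ) := by
  have h := (EuclideanSpace.proj (𝕜 := ℝ) σ).contDiff.comp hU
  have h2 : (⇑(EuclideanSpace.proj (𝕜 := ℝ) σ) ∘ fun p : Pt n ↦ U p.1 p.2) = comp U σ := by
    funext q; simp [comp]
  rwa [h2] at h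

omit [DecidableEq κ] in
/-- **The time derivative of a component** is the component of the right-hand side of the system.
[cite: Friedrichs1954, §1] -/
theorem dT_comp (hU : ContDiff ℝ ∞ fun p : Pt n ↦ U p.1 p.2)
    {V : ℝ → EuclideanSpace ℝ (Fin n) → EuclideanSpace ℝ (Idx κ n)}
    (hUd : ∀ t x, HasDerivAt (fun s ↦ U s x) (V t x) t) (σ : Idx κ n) (p : Pt n) :
    VarWave.dT (comp U σ) p = V p.1 p.2 σ := by
  set Ut : Pt n → EuclideanSpace ℝ (Idx κ n) := fun q ↦ U q.1 q.2 with hUt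
  have hd : DifferentiableAt ℝ Ut p := (hU.differentiable (by simp)) p
  -- the time derivative of `Ut` is the derivative of the curve `s ↦ U s x`
  have hcurve : HasDerivAt (fun s : ℝ ↦ ((s, p.2) : Pt n)) (eT : Pt n) p.1 :=
    (hasDerivAt_id p.1).prodMk (hasDerivAt_const p.1 p.2)
  have hcomp : HasDerivAt (Ut ∘ fun s : ℝ ↦ ((s, p.2) : Pt n)) (fderiv ℝ Ut p eT) p.1 :=
    hd.hasFDerivAt.comp_hasDerivAt p.1 hcurve
  have hfun : (Ut ∘ fun s : ℝ ↦ ((s, p.2) : Pt n)) = fun s ↦ U s p.2 := rfl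
  rw [hfun] at hcomp
  have hval : fderiv ℝ Ut p eT = V p.1 p.2 := hcomp.unique (hUd p.1 p.2)
  -- the component
  have h1 := (EuclideanSpace.proj (𝕜 := ℝ) σ).hasFDerivAt.comp p hd.hasFDerivAt
  have h2 : (⇑(EuclideanSpace.proj (𝕜 := ℝ) σ) ∘ Ut) = comp U σ := by
    funext q; simp [hUt, comp]
  rw [h2] at h1
  unfold VarWave.dT
  rw [h1.fderiv, ContinuousLinearMap.comp_apply, hval]
  simp

omit [DecidableEq κ] in
/-- **The spatial derivatives of a component** are the components of the spatial derivatives of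
the frozen-time field. [folklore] -/
theorem dX_comp (hU : ContDiff ℝ ∞ fun p : Pt n ↦ U p.1 p.2) (σ : Idx κ n) (j : Fin n) (p : Pt n) :
    VarWave.dX (comp U σ) j p = fderiv ℝ (U p.1) p.2 (bv j) σ := by
  set Ut : Pt n → EuclideanSpace ℝ (Idx κ n) := fun q ↦ U q.1 q.2 with hUt
  have hd : DifferentiableAt ℝ Ut p := (hU.differentiable (by simp)) p
  have hsl : HasFDerivAt (fun x : EuclideanSpace ℝ (Fin n) ↦ ((p.1, x) : Pt n))
      (ContinuousLinearMap.inr ℝ ℝ (EuclideanSpace ℝ (Fin n))) p.2 := hasFDerivAt_prodMk_right p.1 p.2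
  have hcomp : HasFDerivAt (U p.1) ((fderiv ℝ Ut p).comp (ContinuousLinearMap.inr ℝ ℝ _)) p.2 := by
    have := hd.hasFDerivAt.comp p.2 hsl
    exact this
  have hval : fderiv ℝ (U p.1) p.2 (bv j) = fderiv ℝ Ut p (eX j) := by
    rw [hcomp.fderiv, ContinuousLinearMap.comp_apply, ContinuousLinearMap.inr_apply, bv_eq_single]
  have h1 := (EuclideanSpace.proj (𝕜 := ℝ) σ).hasFDerivAt.comp p hd.hasFDerivAt
  have h2 : (⇑(EuclideanSpace.proj (𝕜 := ℝ) σ) ∘ Ut) = comp U σ := by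
    funext q; simp [hUt, comp]
  rw [h2] at h1
  unfold VarWave.dX
  rw [h1.fderiv, ContinuousLinearMap.comp_apply, hval]
  simp

/-- **The master identity**: for a classical solution of `∂_t U = Σ_j A_j ∂_j U + B U`,
`∂_t U_σ = Σ_j Σ_τ (A_j)_{στ} ∂_j U_τ + Σ_τ B_{στ} U_τ`. [cite: Friedrichs1954, §1] -/
theorem dT_comp_eq (hU : ContDiff ℝ ∞ fun p : Pt n ↦ U p.1 p.2)
    (hUd : ∀ t x, HasDerivAt (fun s ↦ U s x)
      (foOp (fun j x ↦ C.Aop j (t, x)) (fun x ↦ C.Bop (t, x)) (U t) x) t)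
    (σ : Idx κ n) (p : Pt n) :
    VarWave.dT (comp U σ) p =
      ∑ j, ∑ τ, C.Acoef j p σ τ * VarWave.dX (comp U τ) j p + ∑ τ, C.Bcoef p σ τ * comp U τ p := by
  rw [dT_comp hU hUd σ p, foOp_apply]
  simp only [dX_comp hU, comp_apply, Coeffs.Aop, Coeffs.Bop]
  rw [WithLp.ofLp_add, Pi.add_apply, WithLp.ofLp_sum, Finset.sum_apply]
  simp only [ofCoef_apply]

omit [DecidableEq κ] in
/-- Sums over the index set of the big unknown, slot by slot. [folklore] -/
theorem sum_idx (g : Idx κ n → ℝ) :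
    ∑ τ, g τ = ∑ J, (g (J, none) + g (J, some none) + ∑ l, g (J, some (some l))) := by
  rw [Fintype.sum_prod_type]
  refine Finset.sum_congr rfl fun J _ ↦ ?_
  rw [Fintype.sum_option, Fintype.sum_option]
  ring

variable (hU : ContDiff ℝ ∞ fun p : Pt n ↦ U p.1 p.2)
  (hUd : ∀ t x, HasDerivAt (fun s ↦ U s x)
    (foOp (fun j x ↦ C.Aop j (t, x)) (fun x ↦ C.Bop (t, x)) (U t) x) t)
include hU hUd

/-- **The `f`-rows**: `D₀ f_K = (√a)⁻¹ ϖ_K`. [cite: John1982, Ch. 5 §3] -/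
theorem row_f (K : κ) (q : Pt n) :
    D0 C.β (comp U (K, none)) q = C.isa q * comp U (K, some none) q := by
  have hA : ∀ j, ∑ τ, C.Acoef j q (K, none) τ * VarWave.dX (comp U τ) j q =
      C.β j q * VarWave.dX (comp U (K, none)) j q := fun j ↦ by
    simp only [sum_idx, Coeffs.Acoef, ite_mul, zero_mul, Finset.sum_const_zero, add_zero,
      Finset.sum_ite_eq, Finset.mem_univ, if_true]
  have hB : ∑ τ, C.Bcoef q (K, none) τ * comp U τ q = C.isa q * comp U (K, some none) q := by
    simp only [sum_idx, Coeffs.Bcoef, ite_mul, zero_mul, Finset.sum_const_zero, add_zero, zero_add,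
      Finset.sum_ite_eq, Finset.mem_univ, if_true]
  unfold D0
  rw [dT_comp_eq hU hUd (K, none) q, Finset.sum_congr rfl fun j _ ↦ hA j, hB]
  ring

/-- **The `ψ`-rows**: `D₀ ψ_{K,l} = rowPsi`. [cite: John1982, Ch. 5 §3] -/
theorem row_psi (K : κ) (l : Fin n) (q : Pt n) :
    D0 C.β (comp U (K, some (some l))) q =
      rowPsi C.a C.β C.h C.e (comp U (K, some none)) (fun m ↦ comp U (K, some (some m))) l q := by
  have hA : ∀ j, ∑ τ, C.Acoef j q (K, some (some l)) τ * VarWave.dX (comp U τ) j q =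
      C.isa q * (C.e l j q * VarWave.dX (comp U (K, some none)) j q)
        + C.β j q * VarWave.dX (comp U (K, some (some l))) j q := fun j ↦ by
    simp only [sum_idx, Coeffs.Acoef, ite_mul, zero_mul, zero_add, ite_and, Finset.sum_ite_irrel,
      Finset.sum_const_zero, Finset.sum_ite_eq, Finset.mem_univ, if_true, Finset.sum_add_distrib]
    ring
  have hB : ∑ τ, C.Bcoef q (K, some (some l)) τ * comp U τ q =
      (∑ k, C.e l k q * VarWave.dX C.isa k q) * comp U (K, some none) q
        + ∑ m, Mco C.β C.h C.e l m q * comp U (K, some (some m)) q := by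
    simp only [sum_idx, Coeffs.Bcoef, ite_mul, zero_mul, zero_add, Finset.sum_ite_irrel,
      Finset.sum_const_zero, Finset.sum_ite_eq, Finset.mem_univ, if_true, Finset.sum_add_distrib]
  -- the `M_{lm} ψ_m` terms are the `F`-terms
  have hM : ∑ m, Mco C.β C.h C.e l m q * comp U (K, some (some m)) q =
      ∑ k, D0 C.β (C.e l k) q * Fv C.h C.e (fun m ↦ comp U (K, some (some m))) k q
        + ∑ k, C.e l k q * ∑ j, VarWave.dX (C.β j) k q *
            Fv C.h C.e (fun m ↦ comp U (K, some (some m))) j q := by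
    unfold Mco Fv
    simp only [add_mul, Finset.sum_add_distrib, Finset.sum_mul, Finset.mul_sum]
    congr 1
    · rw [Finset.sum_comm]
      exact Finset.sum_congr rfl fun k _ ↦ Finset.sum_congr rfl fun m _ ↦ by ring
    · rw [Finset.sum_comm]
      refine Finset.sum_congr rfl fun k _ ↦ ?_
      rw [Finset.sum_comm]
      exact Finset.sum_congr rfl fun j _ ↦ Finset.sum_congr rfl fun m _ ↦ by ring
  have hisa : C.isa = fun r ↦ (Real.sqrt (C.a r))⁻¹ := rfl
  unfold D0
  rw [dT_comp_eq hU hUd (K, some (some l)) q, Finset.sum_congr rfl fun j _ ↦ hA j, hB, hM]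
  unfold rowPsi
  rw [hisa]
  simp only [Finset.sum_add_distrib, Finset.mul_sum]
  ring

/-- **The `ϖ`-rows**: `D₀ ϖ_K = rowPi(b_T = b_X = c = 0) + (√a)⁻¹ · (coupling in first-order
variables)`. [cite: John1982, Ch. 5 §3] -/
theorem row_pi (K : κ) (q : Pt n) :
    D0 C.β (comp U (K, some none)) q =
      rowPi C.a C.β C.h C.e 0 0 0 (comp U (K, none)) (comp U (K, some none))
          (fun m ↦ comp U (K, some (some m))) q
        + (Real.sqrt (C.a q))⁻¹ * C.cplFO (fun J ↦ comp U (J, none)) (fun J ↦ comp U (J, some none))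
          (fun J m ↦ comp U (J, some (some m))) K q := by
  have hA : ∀ j, ∑ τ, C.Acoef j q (K, some none) τ * VarWave.dX (comp U τ) j q =
      C.β j q * VarWave.dX (comp U (K, some none)) j q
        + ∑ l, C.isa q * C.e l j q * VarWave.dX (comp U (K, some (some l))) j q := fun j ↦ by
    simp only [sum_idx, Coeffs.Acoef, ite_mul, zero_mul, zero_add, Finset.sum_ite_irrel,
      Finset.sum_const_zero, Finset.sum_ite_eq, Finset.mem_univ, if_true, Finset.sum_add_distrib]
  have hB : ∑ τ, C.Bcoef q (K, some none) τ * comp U τ q =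
      C.isa q * (C.sa q * D0 C.β C.sa q * C.isa q) * comp U (K, some none) q
      + ∑ m, C.isa q * (-(C.a q * ∑ j, D0 C.β (C.β j) q * etil C.h C.e m j q)
          - ∑ l, ∑ j, ∑ k, C.e l j q * VarWave.dX (C.e l k) j q * etil C.h C.e m k q)
          * comp U (K, some (some m)) q
      + ∑ J, (C.isa q * C.c0 K J q * comp U (J, none) q
        + C.isa q * (C.cT K J q * C.isa q) * comp U (J, some none) q
        + ∑ m, (C.isa q * ∑ j, (C.cT K J q * C.β j q + C.cX K J j q) * etil C.h C.e m j q)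
            * comp U (J, some (some m)) q) := by
    simp only [sum_idx, Coeffs.Bcoef, ite_mul, zero_mul, add_mul, Finset.sum_ite_irrel,
      Finset.sum_const_zero, Finset.sum_ite_eq, Finset.mem_univ, if_true, Finset.sum_add_distrib]
    ring
  have hisa : ∀ r, C.isa r = (Real.sqrt (C.a r))⁻¹ := fun r ↦ rfl
  have hsa : C.sa = fun r ↦ Real.sqrt (C.a r) := rfl
  unfold D0
  rw [dT_comp_eq hU hUd (K, some none) q, Finset.sum_congr rfl fun j _ ↦ hA j, hB]
  unfold rowPi bracketPi Coeffs.cplFO Fv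
  simp only [Pi.zero_apply, zero_mul, Finset.sum_const_zero, add_zero, hisa, hsa]
  -- abbreviations
  set ι : ℝ := (Real.sqrt (C.a q))⁻¹ with hι
  set ψ : κ → Fin n → ℝ := fun J m ↦ comp U (J, some (some m)) q with hψ
  -- normal forms of the sums
  have h2 : ∑ x, D0 C.β (C.β x) q * ∑ x_1, etil C.h C.e x_1 x q * ψ K x_1 =
      ∑ m, (∑ j, D0 C.β (C.β j) q * etil C.h C.e m j q) * ψ K m := by
    simp only [Finset.mul_sum, Finset.sum_mul]
    rw [Finset.sum_comm]
    exact Finset.sum_congr rfl fun m _ ↦ Finset.sum_congr rfl fun j _ ↦ by ring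
  have h4 : ∑ x, ∑ x_1, ∑ x_2, C.e x x_1 q * VarWave.dX (C.e x x_2) x_1 q *
        ∑ x', etil C.h C.e x' x_2 q * ψ K x' =
      ∑ m, (∑ l, ∑ j, ∑ k, C.e l j q * VarWave.dX (C.e l k) j q * etil C.h C.e m k q) * ψ K m := by
    simp only [Finset.mul_sum, Finset.sum_mul]
    symm
    rw [Finset.sum_comm]
    refine Finset.sum_congr rfl fun l _ ↦ ?_
    rw [Finset.sum_comm]
    refine Finset.sum_congr rfl fun j _ ↦ ?_
    rw [Finset.sum_comm]
    exact Finset.sum_congr rfl fun k _ ↦ Finset.sum_congr rfl fun m _ ↦ by ring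
  have h5 : ∑ m, ι * (-(C.a q * ∑ j, D0 C.β (C.β j) q * etil C.h C.e m j q)
        - ∑ l, ∑ j, ∑ k, C.e l j q * VarWave.dX (C.e l k) j q * etil C.h C.e m k q) * ψ K m =
      -(ι * C.a q * ∑ m, (∑ j, D0 C.β (C.β j) q * etil C.h C.e m j q) * ψ K m)
        - ι * ∑ m, (∑ l, ∑ j, ∑ k, C.e l j q * VarWave.dX (C.e l k) j q * etil C.h C.e m k q) * ψ K m := by
    rw [Finset.mul_sum, Finset.mul_sum, ← Finset.sum_neg_distrib, ← Finset.sum_sub_distrib]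
    exact Finset.sum_congr rfl fun m _ ↦ by ring
  have h3 : ∑ j, (C.β j q * VarWave.dX (comp U (K, some none)) j q
        + ∑ l, ι * C.e l j q * VarWave.dX (comp U (K, some (some l))) j q) =
      ∑ j, C.β j q * VarWave.dX (comp U (K, some none)) j q
        + ι * ∑ l, ∑ j, C.e l j q * VarWave.dX (comp U (K, some (some l))) j q := by
    rw [Finset.sum_add_distrib, Finset.mul_sum, Finset.sum_comm]
    congr 1
    refine Finset.sum_congr rfl fun l _ ↦ ?_
    rw [Finset.mul_sum]
    exact Finset.sum_congr rfl fun j _ ↦ by ring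
  have hcpl : ∑ J, (ι * C.c0 K J q * comp U (J, none) q + ι * (C.cT K J q * ι) * comp U (J, some none) q
        + ∑ m, (ι * ∑ j, (C.cT K J q * C.β j q + C.cX K J j q) * etil C.h C.e m j q) * ψ J m) =
      ι * ∑ J, (C.c0 K J q * comp U (J, none) q
        + C.cT K J q * (ι * comp U (J, some none) q + ∑ j, C.β j q * ∑ m, etil C.h C.e m j q * ψ J m)
        + ∑ j, C.cX K J j q * ∑ m, etil C.h C.e m j q * ψ J m) := by
    rw [Finset.mul_sum]
    refine Finset.sum_congr rfl fun J _ ↦ ?_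
    have e1 : ∑ m, (ι * ∑ j, (C.cT K J q * C.β j q + C.cX K J j q) * etil C.h C.e m j q) * ψ J m =
        ι * C.cT K J q * ∑ j, C.β j q * ∑ m, etil C.h C.e m j q * ψ J m
          + ι * ∑ j, C.cX K J j q * ∑ m, etil C.h C.e m j q * ψ J m := by
      simp only [Finset.mul_sum, Finset.sum_mul, add_mul, mul_add, Finset.sum_add_distrib]
      congr 1
      · rw [Finset.sum_comm]
        exact Finset.sum_congr rfl fun j _ ↦ Finset.sum_congr rfl fun m _ ↦ by ring
      · rw [Finset.sum_comm]
        exact Finset.sum_congr rfl fun j _ ↦ Finset.sum_congr rfl fun m _ ↦ by ring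
    rw [e1]
    ring
  rw [h3, h5, hcpl, h2, h4]
  ring

end Solution

/-! ### The Cauchy data of the big system -/

section Data

variable (C : Coeffs κ n) (f₀ f₁ : κ → EuclideanSpace ℝ (Fin n) → ℝ)

/-- The entries of the initial value of the big unknown attached to the Cauchy data `(f₀, f₁)`:
`f_K = f₀_K`, `ϖ_K = √a (f₁_K − βʲ ∂_j f₀_K)`, `ψ_{K,l} = e_lᵏ ∂_k f₀_K` at `t = 0`.
[cite: John1982, Ch. 5 §3] -/
def dataFun (y : EuclideanSpace ℝ (Fin n)) : Idx κ n → ℝ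
  | (K, none) => f₀ K y
  | (K, some none) => C.sa ((0 : ℝ), y) *
      (f₁ K y - ∑ j, C.β j ((0 : ℝ), y) * fderiv ℝ (f₀ K) y (bv j))
  | (K, some (some l)) => ∑ k, C.e l k ((0 : ℝ), y) * fderiv ℝ (f₀ K) y (bv k)

/-- **The initial value of the big unknown** attached to the Cauchy data `(f₀, f₁)`.
[cite: John1982, Ch. 5 §3] -/
def dataU (y : EuclideanSpace ℝ (Fin n)) : EuclideanSpace ℝ (Idx κ n) :=
  (EuclideanSpace.equiv (Idx κ n) ℝ).symm (dataFun C f₀ f₁ y)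

variable {C f₀ f₁}

omit [Fintype κ] [DecidableEq κ] in
/-- Components of the initial value. [folklore] -/
@[simp] theorem dataU_apply (y : EuclideanSpace ℝ (Fin n)) (σ : Idx κ n) :
    dataU C f₀ f₁ y σ = dataFun C f₀ f₁ y σ := rfl

/-- Coordinate derivatives of a smooth function are smooth. [folklore] -/
theorem contDiff_fderiv_bv {g : EuclideanSpace ℝ (Fin n) → ℝ} (hg : ContDiff ℝ ∞ g) (k : Fin n) :
    ContDiff ℝ ∞ fun y ↦ fderiv ℝ g y (bv k) :=
  (hg.fderiv_right (m := ∞) le_rfl).clm_apply contDiff_const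

omit [Fintype κ] [DecidableEq κ] in
/-- The entries of the initial value are smooth. [folklore] -/
theorem contDiff_dataFun (hC : C.IsSmooth) (h₀ : ∀ K, ContDiff ℝ ∞ (f₀ K)) (h₁ : ∀ K, ContDiff ℝ ∞ (f₁ K))
    (σ : Idx κ n) : ContDiff ℝ ∞ fun y ↦ dataFun C f₀ f₁ y σ := by
  have hsl : ContDiff ℝ ∞ fun y : EuclideanSpace ℝ (Fin n) ↦ (((0 : ℝ), y) : Pt n) :=
    contDiff_prodMk_right (0 : ℝ)
  obtain ⟨K, s⟩ := σ
  rcases s with _ | _ | l <;> simp only [dataFun]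
  · exact h₀ K
  · exact ((Coeffs.contDiff_sa hC).comp hsl).mul ((h₁ K).sub (ContDiff.sum fun j _ ↦
      ((hC.β j).comp hsl).mul (contDiff_fderiv_bv (h₀ K) j)))
  · exact ContDiff.sum fun k _ ↦ ((hC.e l k).comp hsl).mul (contDiff_fderiv_bv (h₀ K) k)

omit [DecidableEq κ] in
/-- **The initial value is smooth.** [cite: Friedrichs1954, §1] -/
theorem contDiff_dataU (hC : C.IsSmooth) (h₀ : ∀ K, ContDiff ℝ ∞ (f₀ K)) (h₁ : ∀ K, ContDiff ℝ ∞ (f₁ K)) :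
    ContDiff ℝ ∞ (dataU C f₀ f₁) :=
  (EuclideanSpace.equiv (Idx κ n) ℝ).symm.contDiff.comp
    (contDiff_pi.2 fun σ ↦ contDiff_dataFun hC h₀ h₁ σ)

omit [DecidableEq κ] in
/-- **The initial value has compact support** when the data have. [cite: Friedrichs1954, §1] -/
theorem hasCompactSupport_dataU (hc₀ : ∀ K, HasCompactSupport (f₀ K)) (hc₁ : ∀ K, HasCompactSupport (f₁ K)) :
    HasCompactSupport (dataU C f₀ f₁) := by
  set Ks : Set (EuclideanSpace ℝ (Fin n)) := ⋃ K, (tsupport (f₀ K) ∪ tsupport (f₁ K)) with hKs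
  have hKc : IsCompact Ks := isCompact_iUnion fun K ↦ (hc₀ K).union (hc₁ K)
  refine HasCompactSupport.intro hKc fun y hy ↦ ?_
  have hy' : ∀ K, y ∉ tsupport (f₀ K) ∧ y ∉ tsupport (f₁ K) := fun K ↦ by
    constructor <;> intro h <;> exact hy (Set.mem_iUnion.2 ⟨K, by simp [h]⟩)
  have h0 : ∀ K, f₀ K y = 0 := fun K ↦ image_eq_zero_of_notMem_tsupport (hy' K).1
  have h1 : ∀ K, f₁ K y = 0 := fun K ↦ image_eq_zero_of_notMem_tsupport (hy' K).2
  have hd : ∀ K, fderiv ℝ (f₀ K) y = 0 := fun K ↦ by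
    rw [(notMem_tsupport_iff_eventuallyEq.1 (hy' K).1).fderiv_eq]
    exact fderiv_const_apply 0
  ext σ
  obtain ⟨K, s⟩ := σ
  rcases s with _ | _ | l <;> simp [dataFun, h0, h1, hd]

omit [DecidableEq κ] in
/-- Components of the derivative of the initial value. [folklore] -/
theorem fderiv_dataU_apply (hC : C.IsSmooth) (h₀ : ∀ K, ContDiff ℝ ∞ (f₀ K)) (h₁ : ∀ K, ContDiff ℝ ∞ (f₁ K))
    (y v : EuclideanSpace ℝ (Fin n)) (σ : Idx κ n) :
    fderiv ℝ (dataU C f₀ f₁) y v σ = fderiv ℝ (fun y' ↦ dataFun C f₀ f₁ y' σ) y v := by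
  have hd : DifferentiableAt ℝ (dataU C f₀ f₁) y :=
    ((contDiff_dataU hC h₀ h₁).differentiable (by simp)) y
  have h1 := (EuclideanSpace.proj (𝕜 := ℝ) σ).hasFDerivAt.comp y hd.hasFDerivAt
  have h2 : (⇑(EuclideanSpace.proj (𝕜 := ℝ) σ) ∘ dataU C f₀ f₁) = fun y' ↦ dataFun C f₀ f₁ y' σ := by
    funext y'; simp
  rw [h2] at h1
  rw [h1.fderiv]
  simp

end Data

/-! ### Existence of smooth solutions of the coupled second-order system -/

section Existence

variable {C : Coeffs κ n}

/-- **Existence for linear diagonal second-order hyperbolic systems with first-order coupling.**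
For smooth admissible coefficients (`Coeffs.IsSmooth`) whose big first-order system has regular
admissible coefficients in Friedrichs' sense (`IsRegularSymmCoeffFamily`; e.g. coefficients which
are constant outside a compact set) and `C_c^∞` Cauchy data `(f₀, f₁)`, there is a smooth `f` with
`f_K(0, ·) = f₀_K`, `∂_t f_K(0, ·) = f₁_K`, solving `P f_K + (coupling)_K = 0` on a neighbourhood
of the initial slice `{t = 0}` (Friedrichs 1954, Thm. 4.1 via John's reduction, Ch. 5 §3).
[cite: Friedrichs1954, §§1–4] [cite: John1982, Ch. 5 §3] -/
theorem exists_solution (hC : C.IsSmooth)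
    (hreg : IsRegularSymmCoeffFamily (fun j t x ↦ C.Aop j ((t, x) : Pt n))
      (fun t x ↦ C.Bop ((t, x) : Pt n)))
    {f₀ f₁ : κ → EuclideanSpace ℝ (Fin n) → ℝ} (h₀ : ∀ K, ContDiff ℝ ∞ (f₀ K))
    (h₁ : ∀ K, ContDiff ℝ ∞ (f₁ K)) (hc₀ : ∀ K, HasCompactSupport (f₀ K))
    (hc₁ : ∀ K, HasCompactSupport (f₁ K)) :
    ∃ f : κ → Pt n → ℝ, (∀ K, ContDiff ℝ ∞ (f K)) ∧
      (∀ K y, f K ((0 : ℝ), y) = f₀ K y) ∧ (∀ K y, VarWave.dT (f K) ((0 : ℝ), y) = f₁ K y) ∧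
      ∀ x₁ : EuclideanSpace ℝ (Fin n), ∀ᶠ p in 𝓝 (((0 : ℝ), x₁) : Pt n),
        ∀ K, P C.a C.β C.Q 0 0 0 (f K) p + C.cpl f K p = 0 := by
  obtain ⟨U, hU0, hUj, -, hUd⟩ := exists_smooth_solution hreg (contDiff_dataU hC h₀ h₁)
    (hasCompactSupport_dataU hc₀ hc₁)
  set f : κ → Pt n → ℝ := fun K ↦ comp U (K, none) with hf
  set ϖ : κ → Pt n → ℝ := fun K ↦ comp U (K, some none) with hϖ
  set ψ : κ → Fin n → Pt n → ℝ := fun K l ↦ comp U (K, some (some l)) with hψ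
  have hfs : ∀ K, ContDiff ℝ ∞ (f K) := fun K ↦ contDiff_comp hUj _
  have hψs : ∀ K l, ContDiff ℝ ∞ (ψ K l) := fun K l ↦ contDiff_comp hUj _
  have hSne : ∀ q, Real.sqrt (C.a q) ≠ 0 := fun q ↦ (Real.sqrt_pos.2 (hC.apos q)).ne'
  -- the rows
  have Rf : ∀ K q, D0 C.β (f K) q = (Real.sqrt (C.a q))⁻¹ * ϖ K q := fun K q ↦ row_f hUj hUd K q
  have Rψ : ∀ K q l, D0 C.β (ψ K l) q = rowPsi C.a C.β C.h C.e (ϖ K) (ψ K) l q := fun K q l ↦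
    row_psi hUj hUd K l q
  have Rπ : ∀ K q, D0 C.β (ϖ K) q = rowPi C.a C.β C.h C.e 0 0 0 (f K) (ϖ K) (ψ K) q
      + (Real.sqrt (C.a q))⁻¹ * C.cplFO f ϖ ψ K q := fun K q ↦ row_pi hUj hUd K q
  -- the Cauchy data of the components
  have hval : ∀ σ y, comp U σ ((0 : ℝ), y) = dataFun C f₀ f₁ y σ := fun σ y ↦ by
    simp only [comp_apply, hU0, dataU_apply]
  have hdX0 : ∀ σ (y : EuclideanSpace ℝ (Fin n)) k, VarWave.dX (comp U σ) k ((0 : ℝ), y) =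
      fderiv ℝ (fun y' ↦ dataFun C f₀ f₁ y' σ) y (bv k) := fun σ y k ↦ by
    rw [dX_comp hUj σ k ((0 : ℝ), y)]
    simp only [hU0]
    exact fderiv_dataU_apply hC h₀ h₁ y (bv k) σ
  have hf0 : ∀ K y, f K ((0 : ℝ), y) = f₀ K y := fun K y ↦ by
    simp only [hf, hval]; rfl
  have hdXf0 : ∀ K (y : EuclideanSpace ℝ (Fin n)) k, VarWave.dX (f K) k ((0 : ℝ), y) =
      fderiv ℝ (f₀ K) y (bv k) := fun K y k ↦ by
    simp only [hf, hdX0]; rfl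
  have hcons : ∀ K y l, ψ K l ((0 : ℝ), y) = psiF C.e (f K) l ((0 : ℝ), y) := fun K y l ↦ by
    simp only [hψ, hval, psiF, hdXf0]
    rfl
  have hdT0 : ∀ K y, VarWave.dT (f K) ((0 : ℝ), y) = f₁ K y := fun K y ↦ by
    have h := Rf K ((0 : ℝ), y)
    unfold D0 at h
    have hϖ0 : ϖ K ((0 : ℝ), y) = C.sa ((0 : ℝ), y) *
        (f₁ K y - ∑ j, C.β j ((0 : ℝ), y) * fderiv ℝ (f₀ K) y (bv j)) := by
      simp only [hϖ, hval]; rfl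
    rw [hϖ0] at h
    simp only [hdXf0, Coeffs.sa, ← mul_assoc, inv_mul_cancel₀ (hSne _), one_mul] at h
    linarith
  -- recovery of the second-order equations near the slice
  refine ⟨f, hfs, hf0, hdT0, fun x₁ ↦ ?_⟩
  have hrec : ∀ K, ∀ᶠ p in 𝓝 (((0 : ℝ), x₁) : Pt n),
      (∀ l, ψ K l p = psiF C.e (f K) l p) ∧ P C.a C.β C.Q 0 0 0 (f K) p = -C.cplFO f ϖ ψ K p := fun K ↦
    eventually_P_eq_of_rows_source hC.a hC.apos hC.β hC.h hC.e hC.hQ hC.hinv (hfs K) (hψs K)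
      (Rf K) (Rψ K) (Rπ K) (Filter.Eventually.of_forall fun y ↦ hcons K y)
  filter_upwards [Filter.eventually_all.2 hrec] with p hp K
  -- on the event the coupling in first-order variables is the coupling in the jets
  have hF : ∀ J k, Fv C.h C.e (ψ J) k p = VarWave.dX (f J) k p := fun J k ↦ by
    rw [Fv_congr (fun m ↦ (hp J).1 m) k, Fv_psiF hC.hQ hC.hinv]
  have hdT : ∀ J, VarWave.dT (f J) p = (Real.sqrt (C.a p))⁻¹ * ϖ J p
      + ∑ j, C.β j p * VarWave.dX (f J) j p := fun J ↦ by
    have h := Rf J p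
    unfold D0 at h
    linarith
  have hcpl : C.cplFO f ϖ ψ K p = C.cpl f K p := by
    unfold Coeffs.cplFO Coeffs.cpl
    refine Finset.sum_congr rfl fun J _ ↦ ?_
    simp only [hF, hdT, Coeffs.isa]
  rw [(hp K).2, hcpl]
  ring

end Existence

end WaveSystem

end Literature.Analysis.PDE

end
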